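import Summits.AnomalousDissipation.AnomalousDissipation.Theses.MirrorVariety
import Literature.Analysis.FluidPDE.NSGalerkinStationary

/-!
# Negative knowledge for the crux `MirrorVariety.GenericRunawayStokesScaling` (stmt-AnomalousDissipation-2990), I:
# frame — kill shape, the mirror, the a-priori upper Stokes bound, the energy identity

Certified copy of §§1, 2, 6, 9 of the cdisprove work file `Cruxes/GenericRunawayStokesScaling/Disproof.lean`.
The crux was DROPPED from the route `MirrorVariety` at rev 14 (2026-08-16, route-repair; item
stmt-AnomalousDissipation-2990 closed as moot), so the route decl `Theses.MirrorVariety.GenericRunawayStokesScaling`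
no longer exists.  Since then (fix of the 2026-08-16 full-build breakage) the token `GenericRunawayStokesScaling`
in `crux_iff` / `not_crux_iff` is a file-LOCAL NOTATION expanding to the statement of the dropped item, verbatim
from its ledger signature: no constant of that name is declared anywhere, the two theorems keep their text, and
their elaborated types carry the statement itself.  Nothing in this file asserts the crux.
For the steady Galerkin variety `V_S(g) = {(c, ν) : c ∈ galerkinSubspace S, galerkinRHS S ν g c = 0}`:
`crux_iff` / `not_crux_iff` (the crux over `variety`, `Regular`, `StokesRate`, and its exact kill shape —
helpers, neither asserts the crux); `galerkinRHS_neg_neg`, `neg_mem_variety_iff` (the mirror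
`σ(c, ν) = (−c, −ν)` preserves `F` and `V`); `sq_mul_norm_sq_le` (the a-priori UPPER bound
`ν²‖c‖² ≤ ∑‖ĝ_k‖²/(4π²)²` at every point of `V`, both signs of `ν`; so any admissible constant of the crux obeys
`c₀ ≤ ∑‖ĝ_k‖²/(4π²)²`, `stokesRate_constant_le`); `energy_identity`, `force_orthogonal_on_zero_fibre`
(`ν·4π²∑|k|²‖c_k‖² = ∑ Re⟪ĝ_k, c_k⟫` on `V`: a runaway is frustrated iff its direction is `L²`-orthogonal to the
force).  Supports stmt-AnomalousDissipation-2990 (and the sibling support `MirrorDisconnection`, stmt-2989).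
-/

set_option linter.dupNamespace false

noncomputable section

open scoped BigOperators InnerProductSpace ComplexConjugate
open Filter Set Function

namespace Summit.AnomalousDissipation.AnomalousDissipation.Theorems.GenericRunawayStokesScaling.Negative

open Literature.Analysis.FunctionSpaces Literature.Analysis.FunctionSpaces.Torus
open Literature.Analysis.FluidPDE Literature.Analysis.FluidPDE.Torus
open Summit.AnomalousDissipation.AnomalousDissipation.Theses.MirrorVariety

/-! ## §1 Restatement and kill shape -/

/-- The punctured frequency ball `S_N = {k ∈ ℤ³ : 0 < |k|² ≤ N²}` of the crux. [folklore] -/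
abbrev PB (N : ℕ) : Finset (Fin 3 → ℤ) := (freqBall N).erase 0

/-- The steady Galerkin variety `V_N(g) = {(c, ν) : c ∈ galerkinSubspace S, galerkinRHS S ν g c = 0}`. [folklore] -/
def variety (S : Finset (Fin 3 → ℤ)) (g : ↥S → (EuclideanSpace ℂ (Fin 3))) : Set ((↥S → (EuclideanSpace ℂ (Fin 3))) × ℝ) :=
  {z | z.1 ∈ galerkinSubspace S ∧ galerkinRHS S z.2 g z.1 = 0}

/-- The regularity hypothesis of the crux: at every zero, `D F(c, ν)` maps `galerkinSubspace S × ℝ`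
onto `galerkinSubspace S`. [folklore] -/
def Regular (S : Finset (Fin 3 → ℤ)) (g : ↥S → (EuclideanSpace ℂ (Fin 3))) : Prop :=
  ∀ z ∈ variety S g, ∀ w ∈ galerkinSubspace S, ∃ v ∈ galerkinSubspace S, ∃ t : ℝ,
    fderiv ℝ (fun p : (↥S → (EuclideanSpace ℂ (Fin 3))) × ℝ => galerkinRHS S p.2 g p.1) z (v, t) = w

/-- The conclusion of the crux: the Stokes rate `ν²‖c‖² ≥ c₀ > 0` on all far-out points of `V`. [folklore] -/
def StokesRate (S : Finset (Fin 3 → ℤ)) (g : ↥S → (EuclideanSpace ℂ (Fin 3))) : Prop :=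
  ∃ M c₀ : ℝ, 0 < c₀ ∧ ∀ z ∈ variety S g, M ≤ ‖z.1‖ → c₀ ≤ z.2 ^ 2 * ‖z.1‖ ^ 2

/- **The dropped crux, verbatim, as a local notation.**  The route decl
`Theses.MirrorVariety.GenericRunawayStokesScaling` (stmt-AnomalousDissipation-2990) was dropped from the route at
rev 14 (2026-08-16) and the item closed as moot; no constant of that name exists any more.  To keep the two
unfolding helpers below letter for letter (Theorems files are append-only) without declaring a proposition in a
Theorems file, the token is a LOCAL notation for the item's statement, copied from its ledger signature: at every
resolution `N`, for `S = S_N` and every nonzero `g ∈ galerkinSubspace S` which is a regular value of the steady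
Galerkin field on `V = {(c, ν) : c ∈ galerkinSubspace S, galerkinRHS S ν g c = 0}`, there are `M` and `c₀ > 0`
with `c₀ ≤ ν² ‖c‖²` at every `(c, ν) ∈ V` with `M ≤ ‖c‖`.  The notation is invisible outside this file; the
elaborated types of `crux_iff` / `not_crux_iff` contain the statement itself (`quotPrecheck` is off for this one
command only: the binder notation `∀` has no precheck handler; all names in the body are fully qualified). -/
set_option quotPrecheck false in
local notation "GenericRunawayStokesScaling" =>
  (∀ (N : ℕ) (S : Finset (Fin 3 → ℤ)), S = (Literature.Analysis.FunctionSpaces.Torus.freqBall N).erase 0 →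
    ∀ g : ↥S → EuclideanSpace ℂ (Fin 3), g ∈ Literature.Analysis.FluidPDE.galerkinSubspace S → g ≠ 0 →
    ∀ V : Set ((↥S → EuclideanSpace ℂ (Fin 3)) × ℝ),
      V = {z | z.1 ∈ Literature.Analysis.FluidPDE.galerkinSubspace S ∧
        Literature.Analysis.FluidPDE.galerkinRHS S z.2 g z.1 = 0} →
      (∀ z ∈ V, ∀ w ∈ Literature.Analysis.FluidPDE.galerkinSubspace S,
        ∃ v ∈ Literature.Analysis.FluidPDE.galerkinSubspace S, ∃ t : ℝ,
          fderiv ℝ (fun p : (↥S → EuclideanSpace ℂ (Fin 3)) × ℝ =>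
            Literature.Analysis.FluidPDE.galerkinRHS S p.2 g p.1) z (v, t) = w) →
      ∃ M c₀ : ℝ, 0 < c₀ ∧ ∀ z ∈ V, M ≤ ‖z.1‖ → c₀ ≤ z.2 ^ 2 * ‖z.1‖ ^ 2)

/-- **The crux, restated** (definitional unfolding of the `∀ S, S = … → ∀ V, V = … →` binders). [folklore] -/
theorem crux_iff :
    GenericRunawayStokesScaling ↔
      ∀ N : ℕ, ∀ g : ↥(PB N) → (EuclideanSpace ℂ (Fin 3)), g ∈ galerkinSubspace (PB N) → g ≠ 0 →
        Regular (PB N) g → StokesRate (PB N) g := by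
  constructor
  · intro h N g hg hg0 hreg
    exact h N (PB N) rfl g hg hg0 (variety (PB N) g) rfl hreg
  · intro h N S hS g hg hg0 V hV hreg
    subst hS; subst hV
    exact h N g hg hg0 hreg

/-- **Exact kill shape**: a refutation must produce a resolution `N`, a nonzero real solenoidal
force vector `g` which is a REGULAR value, and far-out zeros of arbitrarily small `ν²‖c‖²`. [folklore] -/
theorem not_crux_iff :
    ¬ GenericRunawayStokesScaling ↔
      ∃ N : ℕ, ∃ g : ↥(PB N) → (EuclideanSpace ℂ (Fin 3)), g ∈ galerkinSubspace (PB N) ∧ g ≠ 0 ∧ Regular (PB N) g ∧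
        ∀ M c₀ : ℝ, 0 < c₀ → ∃ z ∈ variety (PB N) g, M ≤ ‖z.1‖ ∧ z.2 ^ 2 * ‖z.1‖ ^ 2 < c₀ := by
  rw [crux_iff]
  constructor
  · intro h
    by_contra hcon
    apply h
    intro N g hg hg0 hreg
    by_contra hsr
    apply hcon
    refine ⟨N, g, hg, hg0, hreg, fun M c₀ hc₀ => ?_⟩
    by_contra hz
    apply hsr
    refine ⟨M, c₀, hc₀, fun z hz' hM => ?_⟩
    by_contra hlt
    exact hz ⟨z, hz', hM, lt_of_not_ge hlt⟩
  · rintro ⟨N, g, hg, hg0, hreg, h⟩ hall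
    obtain ⟨M, c₀, hc₀, hM⟩ := hall N g hg hg0 hreg
    obtain ⟨z, hz, hzM, hlt⟩ := h M c₀ hc₀
    exact (hM z hz hzM).not_gt hlt

/-! ## §2 Punctured balls in integer arithmetic -/

/-- `|k|²` is an integer. [folklore] -/
theorem freqNormSq_eq_intCast (k : Fin 3 → ℤ) : freqNormSq k = ((∑ i, k i ^ 2 : ℤ) : ℝ) := by
  simp [freqNormSq]

/-- Membership in the punctured ball, over `ℤ`: `k ∈ S_N ↔ k ≠ 0 ∧ ∑ kᵢ² ≤ N²`. [folklore] -/
theorem mem_PB_iff {N : ℕ} {k : Fin 3 → ℤ} : k ∈ PB N ↔ k ≠ 0 ∧ (∑ i, k i ^ 2 : ℤ) ≤ (N : ℤ) ^ 2 := by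
  rw [Finset.mem_erase, mem_freqBall, freqNormSq_eq_intCast]
  constructor
  · rintro ⟨h1, h2⟩
    exact ⟨h1, by exact_mod_cast h2⟩
  · rintro ⟨h1, h2⟩
    exact ⟨h1, by exact_mod_cast h2⟩

/-- The punctured ball is symmetric. [folklore] -/
theorem PB_symm (N : ℕ) : ∀ k ∈ PB N, -k ∈ PB N := by
  intro k hk
  rw [Finset.mem_erase] at hk ⊢
  exact ⟨neg_ne_zero.2 hk.1, neg_mem_freqBall.2 hk.2⟩

/-- The mean mode is not in the punctured ball. [folklore] -/
theorem zero_not_mem_PB (N : ℕ) : (0 : Fin 3 → ℤ) ∉ PB N := by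
  simp [Finset.mem_erase]

/-- A nonzero integer vector has `∑ kᵢ² ≥ 1`. [folklore] -/
theorem one_le_sum_sq_of_ne_zero {k : Fin 3 → ℤ} (hk : k ≠ 0) : (1 : ℤ) ≤ ∑ i, k i ^ 2 := by
  obtain ⟨i, hi⟩ : ∃ i, k i ≠ 0 := Function.ne_iff.1 hk
  have h1 : (1 : ℤ) ≤ k i ^ 2 := by
    have := Int.one_le_abs hi
    nlinarith [sq_abs (k i)]
  exact h1.trans (Finset.single_le_sum (f := fun j => k j ^ 2) (fun j _ => sq_nonneg _) (Finset.mem_univ i))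

/-- The parallelogram-type identity `|l + m|² = |l|² + |m|² + 2 l·m` over `ℤ³`. [folklore] -/
theorem sum_sq_add (l m : Fin 3 → ℤ) :
    (∑ i, (l + m) i ^ 2 : ℤ) = ∑ i, l i ^ 2 + ∑ i, m i ^ 2 + 2 * ∑ i, l i * m i := by
  simp only [Pi.add_apply, Fin.sum_univ_three]
  ring

/-- Real scalars act on coefficient vectors through `ℝ ⊂ ℂ`. [folklore] -/
theorem real_smul_coeff {X : Type*} (a : ℝ) (c : X → (EuclideanSpace ℂ (Fin 3))) : a • c = (a : ℂ) • c := by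
  funext k
  change ((a : ℂ)) • c k = (a : ℂ) • c k
  rfl

/-- The Leray multiplier is the identity on coefficients of the Galerkin space. [folklore] -/
theorem leraySym_apply_of_mem {S : Finset (Fin 3 → ℤ)} {g : ↥S → (EuclideanSpace ℂ (Fin 3))} (hg : g ∈ galerkinSubspace S)
    (k : ↥S) : leraySym (k : Fin 3 → ℤ) (g k) = g k :=
  leraySym_of_transversal (hg.2 k)

/-! ## §6 The mirror `σ(c, ν) = (−c, −ν)` and the a-priori UPPER Stokes bound (tightness side)

`F(−c, −ν) = F(c, ν)` (the convection symbol is even, the Stokes term is bilinear in `(ν, c)`), so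
`V` is `σ`-invariant; and the energy identity gives `ν²‖c‖² ≤ ∑_k ‖ĝ_k‖² / (4π²)²` at EVERY point of
`V` (sup norm on the left).  So the constant `c₀` of `StokesRate` can never exceed `∑‖ĝ_k‖²/(4π²)²`,
and at `N = 1` this ceiling is attained identically (§3): the conclusion of the crux is an
`O(1)`-two-sided pinching `c₀ ≤ ν²‖c‖² ≤ C(g)` of every runaway. -/

/-- Extension by zero commutes with negation. [folklore] -/
theorem coeffExt_neg' {S : Finset (Fin 3 → ℤ)} (c : ↥S → (EuclideanSpace ℂ (Fin 3))) : coeffExt S (-c) = -coeffExt S c := by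
  have h := coeffExt_sub (0 : ↥S → (EuclideanSpace ℂ (Fin 3))) c
  rwa [zero_sub, coeffExt_zero, zero_sub] at h

/-- The convection symbol is even: `B(−c, −c') = B(c, c')`. [folklore] -/
theorem convectionCoeff_neg_neg {S : Finset (Fin 3 → ℤ)} (c c' : (Fin 3 → ℤ) → (EuclideanSpace ℂ (Fin 3))) (k : Fin 3 → ℤ) :
    convectionCoeff S (-c) (-c') k = convectionCoeff S c c' k := by
  have h1 : -c = (-1 : ℂ) • c := by rw [neg_one_smul]
  have h2 : -c' = (-1 : ℂ) • c' := by rw [neg_one_smul]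
  rw [h1, h2, convectionCoeff_smul_left, convectionCoeff_smul_right, smul_smul]
  norm_num

/-- **Mirror symmetry of the Galerkin field**: `F(−c, −ν) = F(c, ν)`. [folklore] -/
theorem galerkinRHS_neg_neg {S : Finset (Fin 3 → ℤ)} (ν : ℝ) (g c : ↥S → (EuclideanSpace ℂ (Fin 3))) :
    galerkinRHS S (-ν) g (-c) = galerkinRHS S ν g c := by
  funext k
  rw [galerkinRHS_apply, galerkinRHS_apply, galerkinField_def, galerkinField_def, coeffExt_neg',
    convectionCoeff_neg_neg, Pi.neg_apply, smul_neg, neg_mul, Complex.ofReal_neg, neg_smul, neg_neg]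

/-- **`V` is mirror-invariant**: `(c, ν) ∈ V ↔ (−c, −ν) ∈ V`. [folklore] -/
theorem neg_mem_variety_iff {S : Finset (Fin 3 → ℤ)} (g : ↥S → (EuclideanSpace ℂ (Fin 3))) (z : (↥S → (EuclideanSpace ℂ (Fin 3))) × ℝ) :
    (-z) ∈ variety S g ↔ z ∈ variety S g := by
  show (-z.1 ∈ galerkinSubspace S ∧ galerkinRHS S (-z.2) g (-z.1) = 0) ↔
    (z.1 ∈ galerkinSubspace S ∧ galerkinRHS S z.2 g z.1 = 0)
  rw [Submodule.neg_mem_iff, galerkinRHS_neg_neg]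

/-- **The a-priori UPPER Stokes bound** (Temam's (1.30) in sup norm, both signs of `ν`): at every point
of `V_N(g)`, `ν² ‖c‖² ≤ (∑_k ‖ĝ_k‖²) / (4π²)²`.  Hence `c₀ ≤ ∑‖ĝ_k‖²/(4π²)²` for any admissible
constant in `StokesRate`; the crux asks for the matching LOWER bound along runaways. [folklore] -/
theorem sq_mul_norm_sq_le {N : ℕ} {g : ↥(PB N) → (EuclideanSpace ℂ (Fin 3))} (hg : g ∈ galerkinSubspace (PB N)) :
    ∀ z ∈ variety (PB N) g, z.2 ^ 2 * ‖z.1‖ ^ 2 ≤ (∑ k, ‖g k‖ ^ 2) / (4 * Real.pi ^ 2) ^ 2 := by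
  -- the bound for POSITIVE viscosity, from the tree's a-priori estimate
  have key : ∀ z ∈ variety (PB N) g, 0 < z.2 →
      z.2 ^ 2 * ‖z.1‖ ^ 2 ≤ (∑ k, ‖g k‖ ^ 2) / (4 * Real.pi ^ 2) ^ 2 := by
    intro z hz hν
    have h := sum_freqNormSq_mul_norm_sq_le_of_galerkinRHS_eq_zero hν (PB_symm N) (zero_not_mem_PB N)
      hg.1 hz.1 hz.2
    have h1 : ‖z.1‖ ^ 2 ≤ ∑ k : ↥(PB N), freqNormSq (k : Fin 3 → ℤ) * ‖z.1 k‖ ^ 2 :=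
      (norm_sq_le_sum_norm_sq z.1).trans (sum_norm_sq_le_sum_freqNormSq_mul (zero_not_mem_PB N) z.1)
    have hpos : 0 < (4 * Real.pi ^ 2) ^ 2 := by positivity
    rw [le_div_iff₀ hpos]
    calc z.2 ^ 2 * ‖z.1‖ ^ 2 * (4 * Real.pi ^ 2) ^ 2
        = (4 * Real.pi ^ 2 * z.2) ^ 2 * ‖z.1‖ ^ 2 := by ring
      _ ≤ (4 * Real.pi ^ 2 * z.2) ^ 2 * ∑ k : ↥(PB N), freqNormSq (k : Fin 3 → ℤ) * ‖z.1 k‖ ^ 2 :=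
          mul_le_mul_of_nonneg_left h1 (sq_nonneg _)
      _ ≤ ∑ k, ‖g k‖ ^ 2 := h
  intro z hz
  rcases lt_trichotomy z.2 0 with hneg | hzero | hpos
  · -- mirror to positive viscosity
    have hz' : (-z) ∈ variety (PB N) g := (neg_mem_variety_iff g z).2 hz
    have h := key (-z) hz' (by simpa using hneg)
    simpa [norm_neg] using h
  · rw [hzero]
    have : 0 ≤ (∑ k, ‖g k‖ ^ 2) / (4 * Real.pi ^ 2) ^ 2 := by positivity
    simpa using this
  · exact key z hz hpos

/-- Corollary: every admissible Stokes-rate constant is bounded by the force, `c₀ ≤ ∑‖ĝ_k‖²/(4π²)²`,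
as soon as `V` has a point of norm `≥ M` (e.g. along any runaway). [folklore] -/
theorem stokesRate_constant_le {N : ℕ} {g : ↥(PB N) → (EuclideanSpace ℂ (Fin 3))} (hg : g ∈ galerkinSubspace (PB N))
    {M c₀ : ℝ} (hM : ∀ z ∈ variety (PB N) g, M ≤ ‖z.1‖ → c₀ ≤ z.2 ^ 2 * ‖z.1‖ ^ 2)
    {z : (↥(PB N) → (EuclideanSpace ℂ (Fin 3))) × ℝ} (hz : z ∈ variety (PB N) g) (hzM : M ≤ ‖z.1‖) :
    c₀ ≤ (∑ k, ‖g k‖ ^ 2) / (4 * Real.pi ^ 2) ^ 2 :=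
  (hM z hz hzM).trans (sq_mul_norm_sq_le hg z hz)


/-! ## §9 The energy identity in coordinates and the FRUSTRATION CRITERION -/

/-- **Energy identity at a zero, in coordinates** (Temam (1.29) on the Fourier side): for symmetric `S`,
real `g` and `(c, ν) ∈ V_S(g)`, `ν · 4π² ∑_k |k|² ‖c_k‖² = ∑_k Re⟪ĝ_k, c_k⟫_ℂ`.  Consequently, along
any sequence of zeros with `‖c‖ → ∞` and `c/‖c‖₂ → U`, `ν‖c‖₂ → ⟨g, U⟩ / (4π² ∑|k|²‖U_k‖²)`: a runaway is
FRUSTRATED (`ν‖c‖ → 0`, Puiseux `a < 1`) iff its limiting direction is `L²`-orthogonal to the force, and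
has the Stokes rate iff `⟨g, U⟩ ≠ 0` — the dichotomy the crux legislates. [folklore] -/
theorem energy_identity {S : Finset (Fin 3 → ℤ)} (hS : ∀ k ∈ S, -k ∈ S) {g : ↥S → (EuclideanSpace ℂ (Fin 3))}
    (hg : IsRealCoeff g) {z : (↥S → (EuclideanSpace ℂ (Fin 3))) × ℝ} (hz : z ∈ variety S g) :
    z.2 * (4 * Real.pi ^ 2 * ∑ k : ↥S, freqNormSq (k : Fin 3 → ℤ) * ‖z.1 k‖ ^ 2) =
      ∑ k : ↥S, (inner ℂ (g k) (z.1 k)).re := by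
  have h := galerkin_energy_eq_of_galerkinRHS_eq_zero z.2 hS hg hz.1 hz.2
  rw [toReal_eGradNormSq_realTrigPoly hS (hz.1.1.isConjSymm_coeffExt hS),
    sum_coeffExt (fun k v => freqNormSq k * ‖v‖ ^ 2),
    integral_inner_realTrigPoly_realTrigPoly hS (hg.isConjSymm_coeffExt hS)
      (hz.1.1.isConjSymm_coeffExt hS)] at h
  rw [h, ← Finset.sum_coe_sort]
  exact Finset.sum_congr rfl fun k _ => by rw [coeffExt_coe, coeffExt_coe]

/-- At `ν = 0` every zero is `L²`-orthogonal to the force: `∑_k Re⟪ĝ_k, c_k⟫ = 0` on the `ν = 0` fibre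
(in particular along the line of §5). [folklore] -/
theorem force_orthogonal_on_zero_fibre {S : Finset (Fin 3 → ℤ)} (hS : ∀ k ∈ S, -k ∈ S) {g : ↥S → (EuclideanSpace ℂ (Fin 3))}
    (hg : IsRealCoeff g) {c : ↥S → (EuclideanSpace ℂ (Fin 3))} (hc : ((c, (0 : ℝ)) : (↥S → (EuclideanSpace ℂ (Fin 3))) × ℝ) ∈ variety S g) :
    ∑ k : ↥S, (inner ℂ (g k) (c k)).re = 0 := by
  have h := energy_identity hS hg hc
  simpa using h.symm


end Summit.AnomalousDissipation.AnomalousDissipation.Theorems.GenericRunawayStokesScaling.Negative
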